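import Summits.CriticalPhenomena.PercolationContinuityZ3.Theorems.PercNearOneGluingNoHeavyQuantIndepBlobSubcloudCert
import Summits.CriticalPhenomena.PercolationContinuityZ3.Theorems.PercNearOneGluingNoHeavyQuantIndepBlobHalfShortfall
import HarnessLib

/-!
# QUANT lane R8, Conjecture DIB\* WHENEVER THE LIGHTS BIGGER THAN HALF THE SHORTFALL CARRY THE CREDIT BY THEMSELVES — part (XIV) of the
# cloud series: the half-shortfall certificate as a lemma, discharged through the sub-cloud certificate of part (XIII)

builds on p205010 (kernel theorem, internal audit signed; external expert review pending)

Support file (`--supports stmt-CriticalPhenomena-4575`), QUANT lane census seat prim-quant-census-1 (gen 16), rung R8 of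
`run/shared/lean/prim/quant/LADDER.md`; memo `run/shared/lean/prim/quant/prim-quant-census-1/TRUNCATED-MEAN-G16.md` §6.  Theorems only, no
definitions, no sorries, standard axioms.

* `Quant.IndepBlob.halfShortfall_certificate` — the inequality behind part XII for ANY shortfall parameter `Cp > 0` and any light cloud `L`
  (every light `2a > Cp`, `a ≤ j`, credit `> Cp`): `x·Cp·Π_L(1−p) < Σ_T w_L(T)·Pay(T)` — by THE TRUNCATED-MEAN THEOREM (part VIII) on the
  medium lights and `bigCloud_value` (part X) on the big ones, glued by `sum_powerset_weight_union_mul`.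
* **`Quant.IndepBlob.tail_ge_of_halfShortfallSub`** — `1/2 ≤ x < 1`, heavy credit `C_H < 2j`; SOME sub-cloud `L₀` of the lights with
  `2a > Cp`, `a ≤ j` on `L₀` and `C_H + Σ_{L₀} a·κ_x(p) > 2j` ⟹ `x ≤ P(N ≥ j+1)`, whatever the other lights are (the monotone clamp payment and
  independence reduce the sub-cloud certificate of part XIII to `halfShortfall_certificate` on `L₀`).
* **`Quant.IndepBlob.dibStar_of_halfShortfallSub`** — DIB\*'s binder shape: `C_H = Σ_{x ≤ g} a·g < 2j` and
  `2j < C_H + Σ_{g < x, 2a > 2j − C_H, a ≤ j} a·(g − x²)/(1 − x)` ⟹ the row; i.e. **Conjecture DIB\* holds as soon as the lights bigger than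
  half the shortfall (and of size `≤ j`) carry the missing credit alone** — small or junk lights never hurt.  Contains part XII and all earlier
  cloud families.  (Census, this seat, `code/gen16/coverage_g16c_full.py`: on random many-light corner instances this sub-cloud form adds
  ≈ 12 % coverage to part XII's ≈ 13 %; with the Cantelli rule ε another ≈ 70 %; ≈ 0.3 % remain, all few-big-near-floor-lights shapes.)

[this work; this lane's census]; the gluing rows served: [cite: KozmaNitzan2024, Conjecture 3 (p. 15)]; product weights
[cite: Grimmett1999, §1.3 p. 10].
-/

namespace Summit.CriticalPhenomena.PercolationContinuityZ3.Theorems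

namespace Quant

namespace IndepBlob

open Finset

variable {κ : Type*} [Fintype κ] [DecidableEq κ]

/-! ### 24. The half-shortfall certificate as a lemma -/

omit [Fintype κ] in
set_option maxHeartbeats 400000 in
/-- **The half-shortfall certificate** (the inequality behind `tail_ge_of_halfShortfall`, for a light cloud `L` and any shortfall
`Cp > 0`): `1/2 ≤ x < 1`, gates of `L` in `[0, x)`, sizes `a ≤ j`, credit `Cp < Σ_L a·κ_x(p)`; `B` = the lights
with `Cp < x·a` ⟹ `x·Cp·Π_L(1 − p) < Σ_{T ⊆ L} w_L(T)·Pay(T)`, `Pay(T) = x·Cp·(h/(x²h + (1−x)Cp) − 1)`, `h = min(a(T ∩ B), j)` if `T` meets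
`B`, else `max(0, min(x(a(T) − Cp), (1−x)Cp))`.  (Truncated-mean theorem on `L ∖ B`, `bigCloud_value` on `B`.) [this work] -/
theorem halfShortfall_certificate (p : κ → ℝ) (a : κ → ℕ) (x Cp : ℝ) (hx : 1 / 2 ≤ x) (hx1 : x < 1) (hCp0 : 0 < Cp)
    (hp0 : ∀ k, 0 ≤ p k) (hp1 : ∀ k, p k ≤ 1) (L : Finset κ) (hlight : ∀ k ∈ L, p k < x) (j : ℕ)
    (hsize : ∀ k ∈ L, a k ≤ j) (hcredit : Cp < ∑ k ∈ L, (a k : ℝ) * ((p k - x ^ 2) / (1 - x))) :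
    x * Cp * ∏ k ∈ L, (1 - p k) < ∑ S ∈ L.powerset, (∏ k ∈ L, if k ∈ S then p k else 1 - p k) *
      (if S ∩ L.filter (fun k => Cp < x * (a k : ℝ)) = ∅ then max 0 (min (x * (((∑ k ∈ S, a k : ℕ) : ℝ) - Cp)) ((1 - x) * Cp))
        else x * Cp * (((min (∑ k ∈ S ∩ L.filter (fun k => Cp < x * (a k : ℝ)), a k) j : ℕ) : ℝ) /
          (x ^ 2 * ((min (∑ k ∈ S ∩ L.filter (fun k => Cp < x * (a k : ℝ)), a k) j : ℕ) : ℝ) + (1 - x) * Cp) - 1)) := by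
  have hx0 : 0 < x := by linarith
  have h1x : 0 < 1 - x := by linarith
  have hxCp : 0 < x * Cp := mul_pos hx0 hCp0
  -- carriers = the big lights, `M` = the medium ones
  set B : Finset κ := L.filter (fun k => Cp < x * (a k : ℝ)) with hB
  set M : Finset κ := L.filter (fun k => ¬ Cp < x * (a k : ℝ)) with hM
  have hBM : Disjoint B M := Finset.disjoint_filter_filter_not L L _
  have hLBM : B ∪ M = L := Finset.filter_union_filter_not_eq _ L
  have hBL : ∀ k ∈ B, k ∈ L := fun k hk => (Finset.mem_filter.1 hk).1
  have hML : ∀ k ∈ M, k ∈ L := fun k hk => (Finset.mem_filter.1 hk).1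
  have hBbig : ∀ k ∈ B, Cp < x * (a k : ℝ) := fun k hk => (Finset.mem_filter.1 hk).2
  have hMmed : ∀ k ∈ M, x * (a k : ℝ) ≤ Cp := fun k hk => not_lt.1 (Finset.mem_filter.1 hk).2
  set wL : Finset κ → ℝ := fun S => ∏ k ∈ L, (if k ∈ S then p k else 1 - p k) with hwL
  set ℓ : ℝ → ℝ := fun h => h / (x ^ 2 * h + (1 - x) * Cp) with hℓ
  set t : ℝ := Cp / x with ht
  have hxt : x * t = Cp := by rw [ht]; field_simp
  have ht0 : 0 ≤ t := div_nonneg hCp0.le hx0.le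
  -- the two value functions
  set V : Finset κ → ℝ := fun T =>
    if T = ∅ then (0 : ℝ) else ((T.sup a : ℕ) : ℝ) / (x ^ 2 * ((T.sup a : ℕ) : ℝ) + (1 - x) * Cp) with hV
  set PB : Finset κ → ℝ := fun T =>
    if T = ∅ then (0 : ℝ) else x * Cp * (ℓ ((min (∑ k ∈ T, a k) j : ℕ) : ℝ) - 1) with hPB
  set PM : Finset κ → ℝ := fun S' =>
    x * min (∑ k ∈ S', (a k : ℝ)) t - x * Cp + (if S' = ∅ then x * Cp else 0) with hPM
  set I : Finset κ → ℝ := fun T => if T = ∅ then (1 : ℝ) else 0 with hI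
  change x * Cp * ∏ k ∈ L, (1 - p k) < ∑ S ∈ L.powerset, wL S *
    (if S ∩ B = ∅ then max 0 (min (x * (((∑ k ∈ S, a k : ℕ) : ℝ) - Cp)) ((1 - x) * Cp))
      else x * Cp * (((min (∑ k ∈ S ∩ B, a k) j : ℕ) : ℝ) / (x ^ 2 * ((min (∑ k ∈ S ∩ B, a k) j : ℕ) : ℝ) + (1 - x) * Cp) - 1))
  have hwL0 : ∀ S, 0 ≤ wL S := fun S => weightU_nonneg p L (fun k _ => hp0 k) (fun k _ => hp1 k) S
  -- termwise: `Pay(S) ≥ PB(S ∩ B)·1 + I(S ∩ B)·PM(S ∩ M)`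
  have hterm : ∀ S ∈ L.powerset, wL S * (PB (S ∩ B) * 1) + wL S * (I (S ∩ B) * PM (S ∩ M)) ≤ wL S *
      (if S ∩ B = ∅ then max 0 (min (x * (((∑ k ∈ S, a k : ℕ) : ℝ) - Cp)) ((1 - x) * Cp))
        else x * Cp * (((min (∑ k ∈ S ∩ B, a k) j : ℕ) : ℝ) /
          (x ^ 2 * ((min (∑ k ∈ S ∩ B, a k) j : ℕ) : ℝ) + (1 - x) * Cp) - 1)) := by
    intro S hS
    rw [← mul_add]
    refine mul_le_mul_of_nonneg_left ?_ (hwL0 S)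
    have hSL : S ⊆ L := Finset.mem_powerset.1 hS
    by_cases hSB : S ∩ B = ∅
    · -- clamp outcomes: `S ⊆ M`
      have hSM : S ∩ M = S := by
        refine Finset.inter_eq_left.2 fun k hk => ?_
        have hkL := hSL hk
        rw [← hLBM, Finset.mem_union] at hkL
        rcases hkL with hkB | hkM
        · exact absurd (Finset.mem_inter.2 ⟨hk, hkB⟩) (by rw [hSB]; exact Finset.notMem_empty k)
        · exact hkM
      rw [if_pos hSB, hSB, hSM]
      simp only [hPB, hI, if_true, mul_one, zero_add, one_mul, hPM]
      by_cases hS0 : S = ∅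
      · subst hS0
        rw [if_pos rfl, Finset.sum_empty, min_eq_left ht0, mul_zero, zero_sub, neg_add_cancel]
        exact le_max_left _ _
      · rw [if_neg hS0, add_zero]
        have e : x * min (∑ k ∈ S, (a k : ℝ)) t - x * Cp = min (x * (((∑ k ∈ S, a k : ℕ) : ℝ) - Cp)) ((1 - x) * Cp) := by
          rw [mul_min_of_nonneg _ _ hx0.le, hxt, ← min_sub_sub_right, Nat.cast_sum]
          congr 1 <;> ring
        rw [e]
        exact le_max_right _ _
    · -- carrier outcomes
      rw [if_neg hSB]
      simp only [hPB, hI, if_neg hSB, mul_one, zero_mul, add_zero, hℓ]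
      exact le_rfl
  have hsum := Finset.sum_le_sum hterm
  rw [Finset.sum_add_distrib] at hsum
  -- the two product sums
  have hprodB : ∑ S ∈ L.powerset, wL S * (PB (S ∩ B) * 1) =
      (∑ T ∈ B.powerset, (∏ k ∈ B, if k ∈ T then p k else 1 - p k) * PB T) *
        (∑ S' ∈ M.powerset, (∏ k ∈ M, if k ∈ S' then p k else 1 - p k) * (fun _ => (1 : ℝ)) S') := by
    rw [← sum_powerset_weight_union_mul p B M hBM PB (fun _ => (1 : ℝ)), hLBM]
  have hprodM : ∑ S ∈ L.powerset, wL S * (I (S ∩ B) * PM (S ∩ M)) =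
      (∑ T ∈ B.powerset, (∏ k ∈ B, if k ∈ T then p k else 1 - p k) * I T) *
        (∑ S' ∈ M.powerset, (∏ k ∈ M, if k ∈ S' then p k else 1 - p k) * PM S') := by
    rw [← sum_powerset_weight_union_mul p B M hBM I PM, hLBM]
  rw [hprodB, hprodM] at hsum
  have hM1 : ∑ S' ∈ M.powerset, (∏ k ∈ M, if k ∈ S' then p k else 1 - p k) * (fun _ => (1 : ℝ)) S' = 1 := by
    simp only [mul_one]; exact sum_powerset_weight p M
  have hQB : ∑ T ∈ B.powerset, (∏ k ∈ B, if k ∈ T then p k else 1 - p k) * I T = ∏ k ∈ B, (1 - p k) := by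
    simp only [hI, mul_ite, mul_one, mul_zero]
    rw [Finset.sum_ite_eq' B.powerset (∅ : Finset κ), if_pos (Finset.empty_mem_powerset B)]
    exact Finset.prod_congr rfl fun k _ => by rw [if_neg (Finset.notMem_empty k)]
  rw [hM1, mul_one, hQB] at hsum
  set QB : ℝ := ∏ k ∈ B, (1 - p k) with hQBdef
  set QM : ℝ := ∏ k ∈ M, (1 - p k) with hQMdef
  have hQL : ∏ k ∈ L, (1 - p k) = QB * QM := by rw [← hLBM, Finset.prod_union hBM]
  -- the medium side: `Σ w_M PM = x·T_M − x·Cp + x·Cp·Q_M`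
  set TM : ℝ := ∑ S' ∈ M.powerset, (∏ k ∈ M, if k ∈ S' then p k else 1 - p k) * min (∑ k ∈ S', (a k : ℝ)) t with hTMdef
  have hPMsum : ∑ S' ∈ M.powerset, (∏ k ∈ M, if k ∈ S' then p k else 1 - p k) * PM S' = x * TM - x * Cp + x * Cp * QM := by
    have e2 : ∀ S' ∈ M.powerset, (∏ k ∈ M, if k ∈ S' then p k else 1 - p k) * PM S' =
        x * ((∏ k ∈ M, if k ∈ S' then p k else 1 - p k) * min (∑ k ∈ S', (a k : ℝ)) t) -
          x * Cp * (∏ k ∈ M, if k ∈ S' then p k else 1 - p k) +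
          (if S' = ∅ then (∏ k ∈ M, if k ∈ S' then p k else 1 - p k) * (x * Cp) else 0) := by
      intro S' _
      simp only [hPM]
      split_ifs <;> ring
    rw [Finset.sum_congr rfl e2, Finset.sum_add_distrib, Finset.sum_sub_distrib, ← Finset.mul_sum, ← Finset.mul_sum,
      sum_powerset_weight p M, mul_one, Finset.sum_ite_eq' M.powerset (∅ : Finset κ), if_pos (Finset.empty_mem_powerset M)]
    have : (∏ k ∈ M, if k ∈ (∅ : Finset κ) then p k else 1 - p k) = QM :=
      Finset.prod_congr rfl fun k _ => by rw [if_neg (Finset.notMem_empty k)]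
    rw [this]; ring
  rw [hPMsum] at hsum
  -- the big side: `Σ w_B PB ≥ x·Cp·(E_B − (1 − Q_B))`
  set EB : ℝ := ∑ T ∈ B.powerset, (∏ k ∈ B, if k ∈ T then p k else 1 - p k) * V T with hEBdef
  have hBgate : ∀ k ∈ B, 0 ≤ p k ∧ p k < 1 := fun k hk => ⟨hp0 k, (hlight k (hBL k hk)).trans hx1⟩
  have hPBsum : x * Cp * (EB - (1 - QB)) ≤ ∑ T ∈ B.powerset, (∏ k ∈ B, if k ∈ T then p k else 1 - p k) * PB T := by
    have e3 : x * Cp * (EB - (1 - QB)) =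
        ∑ T ∈ B.powerset, (∏ k ∈ B, if k ∈ T then p k else 1 - p k) * (x * Cp * (V T - (1 - I T))) := by
      have : ∑ T ∈ B.powerset, (∏ k ∈ B, if k ∈ T then p k else 1 - p k) * (x * Cp * (V T - (1 - I T))) =
          x * Cp * (∑ T ∈ B.powerset, (∏ k ∈ B, if k ∈ T then p k else 1 - p k) * V T -
            (∑ T ∈ B.powerset, (∏ k ∈ B, if k ∈ T then p k else 1 - p k) -
              ∑ T ∈ B.powerset, (∏ k ∈ B, if k ∈ T then p k else 1 - p k) * I T)) := by
        rw [← Finset.sum_sub_distrib, ← Finset.sum_sub_distrib, Finset.mul_sum]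
        exact Finset.sum_congr rfl fun T _ => by ring
      rw [this, sum_powerset_weight p B, hQB]
    rw [e3]
    refine Finset.sum_le_sum fun T hT => mul_le_mul_of_nonneg_left ?_
      (weightU_nonneg p B (fun k hk => (hBgate k hk).1) (fun k hk => (hBgate k hk).2.le) T)
    have hTB : T ⊆ B := Finset.mem_powerset.1 hT
    by_cases hT0 : T = ∅
    · simp only [hV, hPB, hI, hT0, if_true]; ring_nf; exact le_rfl
    · simp only [hV, hPB, hI, if_neg hT0, sub_zero, hℓ]
      refine mul_le_mul_of_nonneg_left (sub_le_sub_right ?_ 1) hxCp.le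
      -- `sup a ≤ min(Σ a, j)` and `ℓ` is monotone
      obtain ⟨k₀, hk₀, hsup⟩ := Finset.exists_mem_eq_sup T (Finset.nonempty_iff_ne_empty.2 hT0) a
      have hle : T.sup a ≤ min (∑ k ∈ T, a k) j := by
        rw [hsup]
        exact le_min (Finset.single_le_sum (fun i _ => Nat.zero_le _) hk₀) (hsize k₀ (hBL k₀ (hTB hk₀)))
      exact bigLight_ell_mono x Cp _ _ hx1 hCp0 (Nat.cast_nonneg _) (Nat.cast_le.2 hle)
  -- THE TWO THEOREMS: truncated mean of the medium cloud, value of the big cloud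
  have hTMthm := truncMean_ge_min x hx hx1 p (fun k => (a k : ℝ)) M.card M rfl t ht0
    (fun k hk => ⟨hp0 k, hlight k (hML k hk)⟩) (fun k _ => Nat.cast_nonneg (a k))
    (fun k hk => by rw [ht, le_div_iff₀ hx0, mul_comm]; exact hMmed k hk)
  rw [hxt] at hTMthm
  have hBVthm := bigCloud_value p a x Cp hx0 hx1 hCp0 B.card B rfl hBgate (fun k hk => (hBbig k hk).le)
  change min (∑ k ∈ M, (a k : ℝ) * ((p k - x ^ 2) / (1 - x))) Cp ≤ TM ∧
    (Cp < ∑ k ∈ M, (a k : ℝ) * ((p k - x ^ 2) / (1 - x)) → Cp < TM) at hTMthm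
  change 1 - max 0 (1 - (∑ k ∈ B, (a k : ℝ) * ((p k - x ^ 2) / (1 - x))) / Cp) * QB ≤ EB ∧
    (Cp < ∑ k ∈ B, (a k : ℝ) * ((p k - x ^ 2) / (1 - x)) → 1 < EB) ∧ 1 - QB ≤ EB at hBVthm
  set CB : ℝ := ∑ k ∈ B, (a k : ℝ) * ((p k - x ^ 2) / (1 - x)) with hCBdef
  set CM : ℝ := ∑ k ∈ M, (a k : ℝ) * ((p k - x ^ 2) / (1 - x)) with hCMdef
  have hCsplit : ∑ k ∈ L, (a k : ℝ) * ((p k - x ^ 2) / (1 - x)) = CB + CM := by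
    rw [← hLBM, Finset.sum_union hBM]
  rw [hCsplit] at hcredit
  have hQB0 : 0 < QB := Finset.prod_pos fun k hk => by linarith [(hBgate k hk).2]
  have hQM0 : 0 ≤ QM := Finset.prod_nonneg fun k hk => by linarith [hp1 k]
  have hTM0 : 0 ≤ TM := Finset.sum_nonneg fun S' _ =>
    mul_nonneg (weightU_nonneg p M (fun k _ => hp0 k) (fun k _ => hp1 k) S')
      (le_min (Finset.sum_nonneg fun k _ => Nat.cast_nonneg (a k)) ht0)
  -- the certificate reduces to `Cp·(1 − E_B) < Q_B·T_M`
  have hkey : Cp * (1 - EB) < QB * TM := by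
    rcases lt_or_ge Cp CM with hCM | hCM
    · -- the mediums alone
      have h1 : Cp < TM := hTMthm.2 hCM
      have h2 : 1 - EB ≤ QB := by linarith [hBVthm.2.2]
      calc Cp * (1 - EB) ≤ Cp * QB := mul_le_mul_of_nonneg_left h2 hCp0.le
        _ < TM * QB := mul_lt_mul_of_pos_right h1 hQB0
        _ = QB * TM := mul_comm _ _
    · have h1 : CM ≤ TM := by have := hTMthm.1; rw [min_eq_left hCM] at this; exact this
      rcases lt_or_ge Cp CB with hCB | hCB
      · -- the bigs alone
        have h2 : 1 < EB := hBVthm.2.1 hCB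
        have : Cp * (1 - EB) < 0 := mul_neg_of_pos_of_neg hCp0 (by linarith)
        linarith [mul_nonneg hQB0.le hTM0]
      · -- both together
        have hm : max 0 (1 - CB / Cp) = 1 - CB / Cp := max_eq_right (by rw [sub_nonneg, div_le_one hCp0]; exact hCB)
        have h2 := hBVthm.1
        rw [hm] at h2
        have h3 : Cp * (1 - EB) ≤ (Cp - CB) * QB := by
          have : Cp * ((1 - CB / Cp) * QB) = (Cp - CB) * QB := by field_simp
          nlinarith
        have h4 : (Cp - CB) * QB < CM * QB := mul_lt_mul_of_pos_right (by linarith) hQB0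
        have h5 : CM * QB ≤ TM * QB := mul_le_mul_of_nonneg_right h1 hQB0.le
        linarith
  rw [hQL]
  nlinarith [hsum, hPBsum, hkey, hQB0, hQM0]

/-! ### 25. Discharge through a sub-cloud -/

/-- `max(0, min(x(h − Cp), (1 − x)Cp))` is nondecreasing in `h`. [this work] -/
theorem clampPay_mono (x Cp h₁ h₂ : ℝ) (hx0 : 0 ≤ x) (h12 : h₁ ≤ h₂) :
    max 0 (min (x * (h₁ - Cp)) ((1 - x) * Cp)) ≤ max 0 (min (x * (h₂ - Cp)) ((1 - x) * Cp)) :=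
  max_le_max le_rfl (min_le_min (by nlinarith) le_rfl)

set_option maxHeartbeats 400000 in
/-- **CONJECTURE DIB\* WHENEVER A SUB-CLOUD OF LIGHTS BIGGER THAN HALF THE SHORTFALL CARRIES THE CREDIT.**  Gates in `[0,1]`, floor
`1/2 ≤ x < 1`; the cloud `L` (gates `< x`), heavies off it, `C_H < 2j`; a sub-cloud `L₀ ⊆ L` with `2j < C_H + 2a_k` and `a_k ≤ j` on `L₀` and
`2j < C_H + Σ_{L₀} a·(p − x²)/(1 − x)` ⟹ `x ≤ P(N ≥ j+1)`. [this work] -/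
theorem tail_ge_of_halfShortfallSub (p : κ → ℝ) (a : κ → ℕ) (x : ℝ) (hx : 1 / 2 ≤ x) (hx1 : x < 1)
    (hp0 : ∀ k, 0 ≤ p k) (hp1 : ∀ k, p k ≤ 1) (L : Finset κ) (hheavy : ∀ k, k ∉ L → x ≤ p k) (hlight : ∀ k ∈ L, p k < x) (j : ℕ)
    (hshort : (∑ i ∈ Finset.univ \ L, (a i : ℝ) * p i) < 2 * j) (L₀ : Finset κ) (hL₀ : L₀ ⊆ L)
    (hmid : ∀ k ∈ L₀, (2 * j : ℝ) < (∑ i ∈ Finset.univ \ L, (a i : ℝ) * p i) + 2 * (a k : ℝ))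
    (hsize : ∀ k ∈ L₀, a k ≤ j)
    (hcredit : (2 * j : ℝ) < (∑ i ∈ Finset.univ \ L, (a i : ℝ) * p i) + ∑ k ∈ L₀, (a k : ℝ) * ((p k - x ^ 2) / (1 - x))) :
    x ≤ ∑ s : Finset κ, (∏ k, if k ∈ s then p k else 1 - p k) * (if j + 1 ≤ ∑ k ∈ s, a k then (1 : ℝ) else 0) := by
  have hx0 : 0 < x := by linarith
  set CH : ℝ := ∑ i ∈ Finset.univ \ L, (a i : ℝ) * p i with hCH
  set Cp : ℝ := 2 * j - CH with hCp
  have hCp0 : 0 < Cp := by rw [hCp]; linarith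
  set B : Finset κ := L₀.filter (fun k => Cp < x * (a k : ℝ)) with hB
  have hBL₀ : B ⊆ L₀ := Finset.filter_subset _ _
  have hBbig : ∀ k ∈ B, Cp < x * (a k : ℝ) := fun k hk => (Finset.mem_filter.1 hk).2
  have hcert₀ := halfShortfall_certificate p a x Cp hx hx1 hCp0 hp0 hp1 L₀ (fun k hk => hlight k (hL₀ hk)) j
    hsize (by rw [hCp]; linarith)
  refine tail_ge_of_subcloudCert p a x hx0 hx1 hp0 hp1 L hheavy j L₀ hL₀ hmid B (fun k hk => hsize k (hBL₀ hk)) hBbig ?_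
  change x * Cp * ∏ k ∈ L₀, (1 - p k) < ∑ S ∈ L.powerset, (∏ k ∈ L, if k ∈ S then p k else 1 - p k) *
    (if S ∩ L₀ = ∅ then 0 else if S ∩ B = ∅ then max 0 (min (x * (((∑ k ∈ S, a k : ℕ) : ℝ) - Cp)) ((1 - x) * Cp))
      else x * Cp * (((min (∑ k ∈ S ∩ B, a k) j : ℕ) : ℝ) / (x ^ 2 * ((min (∑ k ∈ S ∩ B, a k) j : ℕ) : ℝ) + (1 - x) * Cp) - 1))
  change x * Cp * ∏ k ∈ L₀, (1 - p k) < ∑ T ∈ L₀.powerset, (∏ k ∈ L₀, if k ∈ T then p k else 1 - p k) *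
    (if T ∩ B = ∅ then max 0 (min (x * (((∑ k ∈ T, a k : ℕ) : ℝ) - Cp)) ((1 - x) * Cp))
      else x * Cp * (((min (∑ k ∈ T ∩ B, a k) j : ℕ) : ℝ) / (x ^ 2 * ((min (∑ k ∈ T ∩ B, a k) j : ℕ) : ℝ) + (1 - x) * Cp) - 1)) at hcert₀
  -- the payment through `S ∩ L₀` is a lower bound, and the other lights integrate out
  set Pay₀ : Finset κ → ℝ := fun T =>
    if T ∩ B = ∅ then max 0 (min (x * (((∑ k ∈ T, a k : ℕ) : ℝ) - Cp)) ((1 - x) * Cp))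
    else x * Cp * (((min (∑ k ∈ T ∩ B, a k) j : ℕ) : ℝ) / (x ^ 2 * ((min (∑ k ∈ T ∩ B, a k) j : ℕ) : ℝ) + (1 - x) * Cp) - 1) with hPay₀
  have hdisj : Disjoint L₀ (L \ L₀) := Finset.disjoint_sdiff
  have hLU : L₀ ∪ (L \ L₀) = L := Finset.union_sdiff_of_subset hL₀
  have hmarg : ∑ S ∈ L.powerset, (∏ k ∈ L, if k ∈ S then p k else 1 - p k) * (Pay₀ (S ∩ L₀) * (fun _ => (1 : ℝ)) (S ∩ (L \ L₀))) =
      (∑ T ∈ L₀.powerset, (∏ k ∈ L₀, if k ∈ T then p k else 1 - p k) * Pay₀ T) * 1 := by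
    rw [← hLU, sum_powerset_weight_union_mul p L₀ (L \ L₀) hdisj Pay₀ (fun _ => (1 : ℝ))]
    simp only [mul_one, sum_powerset_weight]
  simp only [mul_one] at hmarg
  refine lt_of_lt_of_le (hcert₀.trans_eq hmarg.symm) (Finset.sum_le_sum fun S hS => ?_)
  refine mul_le_mul_of_nonneg_left ?_ (weightU_nonneg p L (fun k _ => hp0 k) (fun k _ => hp1 k) S)
  have hSB : S ∩ L₀ ∩ B = S ∩ B := by
    rw [Finset.inter_assoc, Finset.inter_eq_right.2 hBL₀]
  by_cases hS0 : S ∩ L₀ = ∅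
  · -- nothing to pay: `Pay₀(∅) = max(0, min(−x·Cp, (1−x)Cp)) = 0`
    rw [if_pos hS0]
    simp only [hPay₀, hS0, Finset.empty_inter, if_true, Finset.sum_empty, Nat.cast_zero, zero_sub]
    have : min (x * -Cp) ((1 - x) * Cp) ≤ 0 := (min_le_left _ _).trans (by nlinarith)
    exact le_of_eq (le_antisymm (max_le le_rfl this) (le_max_left _ _))
  · rw [if_neg hS0]
    simp only [hPay₀, hSB]
    by_cases hSBe : S ∩ B = ∅
    · rw [if_pos hSBe, if_pos hSBe, Nat.cast_sum, Nat.cast_sum]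
      exact clampPay_mono x Cp _ _ hx0.le
        (Finset.sum_le_sum_of_subset_of_nonneg Finset.inter_subset_left (fun i _ _ => Nat.cast_nonneg (a i)))
    · rw [if_neg hSBe, if_neg hSBe]

/-- **CONJECTURE DIB\* AS SOON AS THE LIGHTS BIGGER THAN HALF THE SHORTFALL CARRY THE CREDIT** (DIB\*'s binder shape, `…QuantDIBStar`):
floor `1/2 ≤ x < 1`, gates in `[0,1]`, heavy credit `C_H = Σ_{x ≤ g} a·g < 2j`, and
`2j < C_H + Σ_{g < x, 2j < C_H + 2a, a ≤ j} a·(g − x²)/(1 − x)` ⟹ `x ≤ P(Σ_{open} a ≥ j+1)`; the other lights are arbitrary. [this work] -/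
theorem dibStar_of_halfShortfallSub (x : ℝ) (hx : 1 / 2 ≤ x) (hx1 : x < 1) (a : κ → ℕ) (g : κ → ℝ) (j : ℕ)
    (hg : ∀ k, 0 ≤ g k ∧ g k ≤ 1)
    (hshort : (∑ i ∈ Finset.univ.filter (fun i => x ≤ g i), (a i : ℝ) * g i) < 2 * j)
    (hcredit : (2 * j : ℝ) < (∑ i ∈ Finset.univ.filter (fun i => x ≤ g i), (a i : ℝ) * g i) +
      ∑ k ∈ Finset.univ.filter (fun k => g k < x ∧
        (2 * j : ℝ) < (∑ i ∈ Finset.univ.filter (fun i => x ≤ g i), (a i : ℝ) * g i) + 2 * (a k : ℝ) ∧ a k ≤ j),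
        (a k : ℝ) * ((g k - x ^ 2) / (1 - x))) :
    x ≤ ∑ W : Finset κ, (∏ k, if k ∈ W then g k else 1 - g k) * (if j + 1 ≤ ∑ k ∈ W, a k then (1 : ℝ) else 0) := by
  set L : Finset κ := Finset.univ.filter (fun k => g k < x) with hL
  have hmemL : ∀ k, k ∈ L ↔ g k < x := fun k => by simp [hL]
  have hUeq : Finset.univ \ L = Finset.univ.filter (fun i => x ≤ g i) := by
    ext i; simp [hL, not_lt]
  rw [← hUeq] at hshort hcredit
  set L₀ : Finset κ := Finset.univ.filter (fun k => g k < x ∧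
    (2 * j : ℝ) < (∑ i ∈ Finset.univ \ L, (a i : ℝ) * g i) + 2 * (a k : ℝ) ∧ a k ≤ j) with hL₀
  have hmemL₀ : ∀ k, k ∈ L₀ ↔ g k < x ∧ (2 * j : ℝ) < (∑ i ∈ Finset.univ \ L, (a i : ℝ) * g i) + 2 * (a k : ℝ) ∧ a k ≤ j :=
    fun k => by rw [hL₀, Finset.mem_filter]; simp
  have hL₀L : L₀ ⊆ L := fun k hk => (hmemL k).2 ((hmemL₀ k).1 hk).1
  exact tail_ge_of_halfShortfallSub g a x hx hx1 (fun k => (hg k).1) (fun k => (hg k).2) L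
    (fun k hk => not_lt.1 fun h => hk ((hmemL k).2 h)) (fun k hk => (hmemL k).1 hk) j hshort L₀ hL₀L
    (fun k hk => ((hmemL₀ k).1 hk).2.1) (fun k hk => ((hmemL₀ k).1 hk).2.2) hcredit

end IndepBlob

end Quant

end Summit.CriticalPhenomena.PercolationContinuityZ3.Theorems
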